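import Literature.NumberTheory.LFunctions.IdealMoebiusCoprime
import HarnessLib

/-!
# Divisor sums of prime-power-defined multiplicative functions on the ideals of `𝓞 K`

Topic `Literature/NumberTheory/LFunctions`, next to `IdealMoebius.lean` / `IdealMoebiusCoprime.lean`
(whose factorization helpers `normalizedFactors_pow_mul`, `pow_count_mul_filter_prod`,
`count_and_filter_pow_mul` are reused). Everything in this file is PROVED.

For `b : Ideal (𝓞 K) → ℕ → ℝ` let `ppMul b 𝔞 = ∏_{P ∣ 𝔞} b(P, v_P(𝔞))` — the multiplicative
function on nonzero ideals with prescribed values on prime powers (the Möbius function, `μ²`,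
`1/φ`, and the sieve weights `b` of Halberstam–Richert / of the tree's `Sieve/CoprimeSquarefreeSums.lean`
are of this form). The main result is the factorization of its divisor sums over the primes,

  `∑_{𝔡 ∣ 𝔞} ppMul b 𝔡 = ∏_{P ∣ 𝔞} (1 + ∑_{1 ≤ j ≤ v_P(𝔞)} b(P, j))`   (`sum_divisors_ppMul`),

by induction on the set of prime factors: the divisors of `P^e 𝔞'` (`P ∤ 𝔞'`) are the `P^j 𝔡'`
with `j ≤ e`, `𝔡' ∣ 𝔞'`, uniquely (unique factorization of ideals). This is the ideal analogue of the
multiplicativity of `σ`-type divisor sums on `ℕ` (Mathlib's `ArithmeticFunction.IsMultiplicative`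
machinery, which does not apply to ideals) and is the tool by which one-dimensional sieve sums over a
number field (`∑_{N𝔲 ≤ x} μ²(𝔲) ∏_{𝔭∣𝔲}(1 + c_𝔭)/N𝔲`, Castillo et al., arXiv:1403.5808, §2.2) are
reduced to harmonic sums.

## References

* H. Halberstam, H.-E. Richert, *Sieve Methods*, Academic Press 1974, Ch. 1 §1 (multiplicative
  functions `g(d) = ∏_{p ∣ d} g(p)` on square-free `d` and their divisor sums). [folklore]
-/

noncomputable section

open Finset UniqueFactorizationMonoid
open scoped NumberField Classical

namespace Literature.NumberTheory.LFunctions.NumberField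

variable {K : Type*} [Field K] [NumberField K]

/-! ## Prime-power-defined multiplicative functions on ideals and their divisor sums -/

/-- The multiplicative function on the nonzero ideals of `𝓞 K` with prescribed values on prime
powers: `ppMul b 𝔞 = ∏_{P ∣ 𝔞} b(P, v_P(𝔞))` (so `b(P, 0)` is never used; think `b(P,0) = 1`).
[folklore] -/
def ppMul (b : Ideal (𝓞 K) → ℕ → ℝ) (𝔞 : Ideal (𝓞 K)) : ℝ :=
  ∏ P ∈ (normalizedFactors 𝔞).toFinset, b P (Multiset.count P (normalizedFactors 𝔞))

variable (b : Ideal (𝓞 K) → ℕ → ℝ)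

/-- `ppMul b (1) = 1`. [folklore] -/
theorem ppMul_top : ppMul b (⊤ : Ideal (𝓞 K)) = 1 := by
  rw [ppMul, ← Ideal.one_eq_top, normalizedFactors_one]
  simp

/-- **Multiplicativity on a prime power times a coprime ideal**: if `P ∤ D'` then
`ppMul b (P^n D') = b(P, n) · ppMul b D'` for `n ≥ 1`, and `= ppMul b D'` for `n = 0`. [folklore] -/
theorem ppMul_pow_mul {P D' : Ideal (𝓞 K)} (hP : Prime P) (hD'0 : D' ≠ ⊥)
    (hPn : P ∉ normalizedFactors D') (n : ℕ) :
    ppMul b (P ^ n * D') = (if n = 0 then 1 else b P n) * ppMul b D' := by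
  rcases Nat.eq_zero_or_pos n with rfl | hn
  · simp
  rw [if_neg hn.ne']
  have hnf := normalizedFactors_pow_mul hP hD'0 n
  have hPrep : P ∉ (normalizedFactors D').toFinset := by rwa [Multiset.mem_toFinset]
  have htf : (normalizedFactors (P ^ n * D')).toFinset = insert P (normalizedFactors D').toFinset := by
    rw [hnf, Multiset.toFinset_add, Multiset.toFinset_replicate, if_neg hn.ne']
    rfl
  rw [ppMul, ppMul, htf, Finset.prod_insert hPrep]
  congr 1
  · rw [hnf, Multiset.count_add, Multiset.count_replicate_self, Multiset.count_eq_zero.2 hPn, add_zero]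
  · refine Finset.prod_congr rfl fun Q hQ => ?_
    have hQP : Q ≠ P := fun h => hPrep (h ▸ hQ)
    rw [hnf, Multiset.count_add, Multiset.count_replicate, if_neg (Ne.symm hQP), zero_add]

/-- The `P`-free part of `𝔞`: its factorization and support. [folklore] -/
theorem normalizedFactors_filter_prod (𝔞 P : Ideal (𝓞 K)) :
    normalizedFactors (((normalizedFactors 𝔞).filter (· ≠ P)).prod) =
      (normalizedFactors 𝔞).filter (· ≠ P) :=
  normalizedFactors_prod_of_prime fun Q hQ => prime_of_normalized_factor Q (Multiset.mem_of_mem_filter hQ)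

/-- **Divisor sums of prime-power-defined multiplicative functions factor over the primes**: for
`𝔞 ≠ 0` and `D` the finset of divisors of `𝔞`,
`∑_{𝔡 ∣ 𝔞} ppMul b 𝔡 = ∏_{P ∣ 𝔞} (1 + ∑_{1 ≤ j ≤ v_P(𝔞)} b(P, j))`
(written with `b₀(P, j) = [j = 0] + [j ≥ 1] b(P, j)` summed over `j ≤ v_P(𝔞)`). Induction on the set
of prime factors: the divisors of `P^e 𝔞'` (`P ∤ 𝔞'`) are the `P^j 𝔡'`, `j ≤ e`, `𝔡' ∣ 𝔞'`, uniquely.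
[folklore] -/
theorem sum_divisors_ppMul {𝔞 : Ideal (𝓞 K)} (h𝔞 : 𝔞 ≠ ⊥) {D : Finset (Ideal (𝓞 K))}
    (hD : ∀ 𝔡, 𝔡 ∈ D ↔ 𝔡 ∣ 𝔞) :
    ∑ 𝔡 ∈ D, ppMul b 𝔡 =
      ∏ P ∈ (normalizedFactors 𝔞).toFinset,
        ∑ j ∈ Finset.range (Multiset.count P (normalizedFactors 𝔞) + 1), (if j = 0 then 1 else b P j) := by
  -- induction on the finite set of prime factors
  suffices key : ∀ (S : Finset (Ideal (𝓞 K))) (𝔞 : Ideal (𝓞 K)), 𝔞 ≠ ⊥ →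
      (normalizedFactors 𝔞).toFinset = S → ∀ D : Finset (Ideal (𝓞 K)), (∀ 𝔡, 𝔡 ∈ D ↔ 𝔡 ∣ 𝔞) →
      ∑ 𝔡 ∈ D, ppMul b 𝔡 = ∏ P ∈ S,
        ∑ j ∈ Finset.range (Multiset.count P (normalizedFactors 𝔞) + 1), (if j = 0 then 1 else b P j) from
    key _ 𝔞 h𝔞 rfl D hD
  intro S
  induction S using Finset.induction_on with
  | empty =>
    intro 𝔞 h𝔞 hS D hD
    have h𝔞1 : 𝔞 = ⊤ := by
      have h0 : normalizedFactors 𝔞 = 0 := Multiset.toFinset_eq_empty.1 hS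
      rwa [normalizedFactors_eq_zero_iff (by rwa [Ne, Ideal.zero_eq_bot]), Ideal.isUnit_iff] at h0
    subst h𝔞1
    have hD1 : D = {⊤} := by
      ext 𝔡
      rw [hD, Finset.mem_singleton, ← Ideal.one_eq_top, ← isUnit_iff_dvd_one, Ideal.isUnit_iff,
        Ideal.one_eq_top]
    rw [hD1, Finset.sum_singleton, ppMul_top, Finset.prod_empty]
  | insert P S' hPS' ih =>
    intro 𝔞 h𝔞 hS D hD
    have h𝔞0 : (𝔞 : Ideal (𝓞 K)) ≠ 0 := by rwa [Ne, Ideal.zero_eq_bot]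
    have hPmem : P ∈ normalizedFactors 𝔞 := by
      rw [← Multiset.mem_toFinset, hS]; exact Finset.mem_insert_self _ _
    have hP : Prime P := prime_of_normalized_factor P hPmem
    set e : ℕ := Multiset.count P (normalizedFactors 𝔞) with he
    set 𝔞' : Ideal (𝓞 K) := ((normalizedFactors 𝔞).filter (· ≠ P)).prod with h𝔞'
    have hdecomp : P ^ e * 𝔞' = 𝔞 := pow_count_mul_filter_prod h𝔞
    have hnf' : normalizedFactors 𝔞' = (normalizedFactors 𝔞).filter (· ≠ P) :=
      normalizedFactors_filter_prod 𝔞 P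
    have h𝔞'0 : 𝔞' ≠ ⊥ := by
      intro h; rw [h, Ideal.mul_bot] at hdecomp; exact h𝔞 hdecomp.symm
    have hS' : (normalizedFactors 𝔞').toFinset = S' := by
      rw [hnf', Multiset.toFinset_filter, hS, Finset.filter_insert, if_neg (by simp),
        Finset.filter_eq_self]
      intro Q hQ hQP
      exact hPS' (hQP ▸ hQ)
    have hPnot : P ∉ normalizedFactors 𝔞' := by
      rw [hnf', Multiset.mem_filter]; exact fun h => h.2 rfl
    have hsupp' : ∀ {𝔡' : Ideal (𝓞 K)}, 𝔡' ∣ 𝔞' → 𝔡' ∈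
        {D : Ideal (𝓞 K) | D ≠ ⊥ ∧ ∀ Q ∈ normalizedFactors D, Q ∈ S'} := by
      intro 𝔡' h
      have h𝔡'0 : 𝔡' ≠ ⊥ := by
        rintro rfl
        rw [Ideal.dvd_iff_le, le_bot_iff] at h
        exact h𝔞'0 h
      refine ⟨h𝔡'0, fun Q hQ => ?_⟩
      have hle := (dvd_iff_normalizedFactors_le_normalizedFactors
        (by rwa [Ne, Ideal.zero_eq_bot]) (by rwa [Ne, Ideal.zero_eq_bot])).1 h
      rw [← hS', Multiset.mem_toFinset]
      exact Multiset.mem_of_le hle hQ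
    -- divisors of `𝔞'`
    set D' : Finset (Ideal (𝓞 K)) := D.filter (· ∣ 𝔞') with hD'
    have hD'mem : ∀ 𝔡, 𝔡 ∈ D' ↔ 𝔡 ∣ 𝔞' := by
      intro 𝔡
      rw [hD', Finset.mem_filter, hD]
      exact ⟨fun h => h.2, fun h => ⟨h.trans ⟨P ^ e, by rw [mul_comm, hdecomp]⟩, h⟩⟩
    have hIH := ih 𝔞' h𝔞'0 hS' D' hD'mem
    -- counts at `Q ≠ P` are unchanged
    have hcount : ∀ Q ∈ S', Multiset.count Q (normalizedFactors 𝔞) =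
        Multiset.count Q (normalizedFactors 𝔞') := by
      intro Q hQ
      have hQP : Q ≠ P := fun h => hPS' (h ▸ hQ)
      rw [hnf', Multiset.count_filter_of_pos (p := fun x => x ≠ P) hQP]
    rw [Finset.prod_insert hPS', Finset.prod_congr rfl fun Q hQ => by rw [hcount Q hQ], ← hIH,
      Finset.sum_mul_sum, ← Finset.sum_product']
    -- the bijection `(j, 𝔡') ↦ P^j 𝔡'`
    symm
    refine Finset.sum_bij (fun q _ => P ^ q.1 * q.2) ?_ ?_ ?_ ?_
    · rintro ⟨j, 𝔡'⟩ hq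
      rw [Finset.mem_product, Finset.mem_range, hD'mem] at hq
      rw [hD, ← hdecomp]
      exact mul_dvd_mul (pow_dvd_pow P (Nat.lt_succ_iff.1 hq.1)) hq.2
    · rintro ⟨j, 𝔡'⟩ hq ⟨j₁, 𝔡₁'⟩ hq₁ h
      rw [Finset.mem_product, Finset.mem_range, hD'mem] at hq hq₁
      have h1 := count_and_filter_pow_mul hP hPS' j (hsupp' hq.2)
      have h2 := count_and_filter_pow_mul hP hPS' j₁ (hsupp' hq₁.2)
      simp only at h
      rw [h] at h1
      exact Prod.ext (h1.1.symm.trans h2.1) (h1.2.symm.trans h2.2)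
    · intro 𝔡 h𝔡
      rw [hD] at h𝔡
      have h𝔡0 : 𝔡 ≠ ⊥ := by
        rintro rfl
        rw [Ideal.dvd_iff_le, le_bot_iff] at h𝔡
        exact h𝔞 h𝔡
      set j := Multiset.count P (normalizedFactors 𝔡) with hj
      set 𝔡' := ((normalizedFactors 𝔡).filter (· ≠ P)).prod with h𝔡'
      have hle := (dvd_iff_normalizedFactors_le_normalizedFactors
        (by rwa [Ne, Ideal.zero_eq_bot]) h𝔞0).1 h𝔡
      refine ⟨⟨j, 𝔡'⟩, ?_, pow_count_mul_filter_prod h𝔡0⟩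
      rw [Finset.mem_product, Finset.mem_range, hD'mem, Nat.lt_succ_iff]
      refine ⟨Multiset.le_iff_count.1 hle P, ?_⟩
      have h𝔡'0 : (𝔡' : Ideal (𝓞 K)) ≠ 0 := by
        refine Multiset.prod_ne_zero fun h => ?_
        exact (prime_of_normalized_factor 0 (Multiset.mem_of_mem_filter h)).ne_zero rfl
      rw [dvd_iff_normalizedFactors_le_normalizedFactors h𝔡'0 (by rwa [Ne, Ideal.zero_eq_bot]),
        normalizedFactors_filter_prod, hnf']
      exact Multiset.filter_le_filter _ hle
    · rintro ⟨j, 𝔡'⟩ hq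
      rw [Finset.mem_product, Finset.mem_range, hD'mem] at hq
      obtain ⟨h𝔡'0, -⟩ := hsupp' hq.2
      have hPn : P ∉ normalizedFactors 𝔡' := by
        intro h
        have hle := (dvd_iff_normalizedFactors_le_normalizedFactors
          (by rwa [Ne, Ideal.zero_eq_bot]) (by rwa [Ne, Ideal.zero_eq_bot] : (𝔞' : Ideal (𝓞 K)) ≠ 0)).1 hq.2
        exact hPnot (Multiset.mem_of_le hle h)
      rw [ppMul_pow_mul b hP h𝔡'0 hPn j]

end Literature.NumberTheory.LFunctions.NumberField
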